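import Summits.BirchSwinnertonDyer.BirchSwinnertonDyer.Theorems.TameQuarticSolventSolventPairLowerBoundSupersingular
import HarnessLib

/-!
# Route `TameQuarticSolvent`, crux `SolventPairLowerBound` (stmt-BirchSwinnertonDyer-21391), split child
# `LowerBSD3OverSolventQuartic` (stmt-BirchSwinnertonDyer-23963, K1⁻): THE GOOD-REDUCTION HABITAT OF THE
# (t′) LEAF ABOVE `3` — converse half and supersingularity

HONEST FRAMING. Theorems only; a helper for the split child `LowerBSD3OverSolventQuartic` (K1⁻: the LOWER
half of BSD₃ for `E ⊗ M` over a totally real quartic `M` at whose places `w ∣ 3`, `e(w|3) = 4`, the curve is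
good) of the deciding crux `SolventPairLowerBound` of route `TameQuarticSolvent`
(`--supports stmt-BirchSwinnertonDyer-23963`). Nothing here is an Iwasawa-theoretic input: the file only
pins down, in the kernel, OVER WHICH FIELDS the (t′) leaf becomes good (resp. semistable) above `3` and what
the reduction looks like there — the habitat in which any mechanism for K1⁻ has to live (lead memo
`Cruxes/SolventPairLowerBound/LEAD-g4-21391.md` §2, repair census R4/R5). The crux stays OPEN (lead tqs-p1 g4:
blocked-on stmt-BirchSwinnertonDyer-23739) and BSD is not proved by any of this.

WHAT. For `W/ℚ` globally minimal, elliptic, additive at `3` of census class (t′) (`Addv W 3`,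
`Additive.SubTprime W 3`: `ord₃ j ≥ 0`, `f₃ = 2`, semistability index `∤ 2`, Kodaira `III`/`III*`), any
number field `L` and any place `v ∋ 3` of `L`:
* `hasGoodReductionAt_baseChange_of_four_dvd_ramificationIdx` — **`4 ∣ e(v|3)` ⟹ `E_L` is GOOD at `v`.**
  This is the `p = 3` converse half that the tree's criterion at `p ≥ 5`
  (`Additive.hasGoodReductionAt_baseChange_of_semistabilityIndex_dvd_ramificationIdx`, Silverman VII.5.1(a),
  residue characteristic `≥ 5`) cannot reach, and it extends the line's registered stub `stub_goodReduction`
  (`e(v|3) = 4` exactly) to the whole habitat `4 ∣ e(v|3)` — tame `e = 4, 8` and wild `e = 12, 24, …` alike.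
  Proof: the rational companion model of `exists_rat_model_of_subTprime` (`ord₃ Δ = 3k`, `4·ord₃ aᵢ ≥ ik`,
  `k ∈ {1,3}`) fed to the tame descent `hasGoodReductionAt_baseChange_of_padicValRat` with
  `(e, k) := (4m, mk)`.
* `frobeniusTraceAt_baseChange_eq_zero_of_four_dvd_ramificationIdx`,
  `natCard_point_reductionAt_baseChange_of_four_dvd_ramificationIdx` — on the whole habitat, at every `v`
  with `4 ∣ e(v|3)` and ODD residue degree: `a_v(E_L) = 0` and `#Ẽ_v(k_v) = #k_v + 1` (good SUPERSINGULAR,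
  trace zero), extending `frobeniusTraceAt_baseChange_eq_zero_of_subTprime` (`e = 4`).
* `not_hasMultiplicativeReductionAt_baseChange_of_subTprime`,
  `hasGoodReductionAt_of_isSemistableAt_baseChange` — a (t′) curve is NEVER multiplicative above `3`, so
  "semistable at `v`" already means "good at `v`": there is no semistable-but-not-good base for the leaf
  (repair-census entry R5 of LEAD-g4 §2 in kernel form), and
  `isSemistableAt_baseChange_of_four_dvd_ramificationIdx` records the habitat inclusion for semistability.
* `forall_hasGoodReductionAt_of_forall_ramificationIdx_eq_four` — in the child's own binder currency: its
  hypothesis «`E_M` good at every `w ∣ 3`» FOLLOWS from its hypothesis «`e(w|3) = 4` at every `w ∣ 3`» (the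
  line's stub `stub_goodReduction`), so the good-reduction binder of 23963 is dischargeable, not an assumption.
The forward half (`E_L` good at `v` ⟹ `4 ∣ e(v|3)`, hence `e(v|3) ≥ 4 > p = 3` on every good base: no
unramified, quadratic or `e ∣ p − 1` base, i.e. outside B. D. Kim's `e < p` and Delbourgo's Hyp. (G)) follows
from `Additive.semistabilityIndex_dvd_ramificationIdx_of_hasGoodReductionAt` and is being landed by the sibling
width seat (tqs-p1-w2 g3) in its own file; together the two halves give the local criterion
`good at v ↔ semistable at v ↔ 4 ∣ e(v|3)` at `p = 3` on the (t′) cell, the twin of the tree's `p ≥ 5`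
criterion `Additive.hasGoodReductionAt_baseChange_iff_semistabilityIndex_dvd`.

References: J. H. Silverman, *AEC* VII.1 (Remark 1.1, Prop. 1.3), VII.5.1; J.-P. Serre, J. Tate, Ann. of
Math. 88 (1968) §2 Cor. 2; K. Ireland, M. Rosen, *A Classical Introduction to Modern Number Theory*,
Ch. 18 §4 Thm. 5; I. Papadopoulos, J. Number Theory 44 (1993) Table III.
-/

-- D-0017: single-problem summit, so `Summit.BirchSwinnertonDyer.BirchSwinnertonDyer.…` repeats a namespace BY DESIGN.
set_option linter.dupNamespace false

noncomputable section

open scoped NumberField Classical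

open IsDedekindDomain IsDedekindDomain.HeightOneSpectrum NumberField WeierstrassCurve
  Literature.NumberTheory.EllipticCurves Literature.NumberTheory.EllipticCurves.Rank1Residual
  Summit.BirchSwinnertonDyer.Rank1Residual.Additive
  Summit.BirchSwinnertonDyer.BirchSwinnertonDyer.Theorems.SolventPairLowerBound

namespace Summit.BirchSwinnertonDyer.BirchSwinnertonDyer.Theorems.LowerBSD3OverSolventQuartic

/-! ## §0 The ramification index of a place above `p` is positive -/

/-- For a place `v ∋ p` of a number field `L`, `e(v|p) ≠ 0` (Mathlib: `v` lies over `(p)`, and the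
ramification index of a prime lying over a nonzero prime of a Dedekind extension is nonzero). [folklore] -/
theorem ramificationIdx_int_ne_zero_of_natCast_mem (L : Type) [Field L] [NumberField L]
    (v : HeightOneSpectrum (𝓞 L)) (p : ℕ) [hp : Fact p.Prime] (hv : (p : 𝓞 L) ∈ v.asIdeal) :
    v.asIdeal.ramificationIdx ℤ ≠ 0 := by
  haveI : v.asIdeal.LiesOver (Ideal.span {(p : ℤ)}) := liesOver_span_of_natCast_mem p L v hv
  haveI := v.isPrime
  have hp0 : Ideal.span {(p : ℤ)} ≠ ⊥ := by
    rw [Ne, Ideal.span_singleton_eq_bot]; exact_mod_cast hp.out.ne_zero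
  rw [← Ideal.ramificationIdx'_eq_ramificationIdx (Ideal.span {(p : ℤ)}) v.asIdeal hp0]
  exact Ideal.IsDedekindDomain.ramificationIdx'_ne_zero_of_liesOver v.asIdeal hp0

variable (W : WeierstrassCurve ℚ) [W.IsElliptic] [W.IsGloballyMinimal]

/-! ## §1 The converse half of the habitat: `4 ∣ e(v|3)` makes a (t′) curve good at `v` -/

/-- **`4 ∣ e(v|3)` ⟹ good reduction at `v`, for the (t′) leaf at `3`.** Let `W/ℚ` be globally minimal,
elliptic, additive at `3` of census class (t′) (`Addv W 3`, `SubTprime W 3`). Then over EVERY number field `L`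
and at EVERY place `v ∋ 3` whose ramification index `e(v|3)` is divisible by `4`, `W ⊗ L` has good reduction
at `v`. Proof: write `e(v|3) = 4m`; the rational companion model `C • W` of `exists_rat_model_of_subTprime`
has `ord₃ Δ = 3k` and `aᵢ = 0 ∨ ik ≤ 4·ord₃ aᵢ` (`k ∈ {1, 3}`), hence `e(v|3)·ord₃ Δ = 12(mk)` and
`i(mk) ≤ e(v|3)·ord₃ aᵢ`; the tame descent `hasGoodReductionAt_baseChange_of_padicValRat` (rescale by the
`mk`-th power of a uniformiser; Silverman VII.1 Remark 1.1, VII.5.1(a)) gives good reduction of `(C • W) ⊗ L`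
at `v`, and good reduction is invariant under the change of variables `C`. This is Serre–Tate's "potentially
good reduction of index `e = 4` is realised over every extension whose ramification index `4` divides", in
explicit form at `p = 3` (where Silverman VII.5.1(a)'s `j`-criterion is unavailable); it extends the line's
stub `stub_goodReduction` (`e(v|3) = 4`) to `e(v|3) ∈ {4, 8, 12, …}`.
[cite: SerreTate1968, §2 Cor. 2] [cite: SilvermanAEC2009, VII.1 Remark 1.1 and Prop. VII.5.1(a)] -/
theorem hasGoodReductionAt_baseChange_of_four_dvd_ramificationIdx (hadd : Addv W 3)
    (hsub : Summit.BirchSwinnertonDyer.Rank1Residual.Additive.SubTprime W 3)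
    (L : Type) [Field L] [NumberField L] (v : HeightOneSpectrum (𝓞 L))
    (h3 : ((3 : ℕ) : 𝓞 L) ∈ v.asIdeal) (h4 : 4 ∣ v.asIdeal.ramificationIdx ℤ) :
    (W.baseChange L).HasGoodReductionAt v := by
  obtain ⟨m, hm⟩ := h4
  obtain ⟨C, k, -, hΔ, h₁, h₂, h₃, h₄, h₆⟩ := exists_rat_model_of_subTprime W hadd hsub
  haveI : (C • W).IsElliptic := inferInstance
  have hm0 : (0 : ℤ) ≤ m := Nat.cast_nonneg m
  -- scale the coefficient conditions `ik ≤ 4 ord aᵢ` by `m ≥ 0`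
  have h₁' : (C • W).a₁ = 0 ∨ ((m * k : ℕ) : ℤ) ≤ ((4 * m : ℕ) : ℤ) * padicValRat 3 (C • W).a₁ :=
    h₁.imp id fun h ↦ by push_cast; nlinarith
  have h₂' : (C • W).a₂ = 0 ∨ 2 * ((m * k : ℕ) : ℤ) ≤ ((4 * m : ℕ) : ℤ) * padicValRat 3 (C • W).a₂ :=
    h₂.imp id fun h ↦ by push_cast; nlinarith
  have h₃' : (C • W).a₃ = 0 ∨ 3 * ((m * k : ℕ) : ℤ) ≤ ((4 * m : ℕ) : ℤ) * padicValRat 3 (C • W).a₃ :=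
    h₃.imp id fun h ↦ by push_cast; nlinarith
  have h₄' : (C • W).a₄ = 0 ∨ 4 * ((m * k : ℕ) : ℤ) ≤ ((4 * m : ℕ) : ℤ) * padicValRat 3 (C • W).a₄ :=
    h₄.imp id fun h ↦ by push_cast; nlinarith
  have h₆' : (C • W).a₆ = 0 ∨ 6 * ((m * k : ℕ) : ℤ) ≤ ((4 * m : ℕ) : ℤ) * padicValRat 3 (C • W).a₆ :=
    h₆.imp id fun h ↦ by push_cast; nlinarith
  have hgood : ((C • W).baseChange L).HasGoodReductionAt v :=
    hasGoodReductionAt_baseChange_of_padicValRat (C • W) 3 (e := 4 * m) (k := m * k)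
      (by rw [hΔ]; push_cast; ring) h₁' h₂' h₃' h₄' h₆' L v h3 hm
  have hbc : (C • W).baseChange L = (C.map (algebraMap ℚ L)) • W.baseChange L := by
    rw [WeierstrassCurve.baseChange, ← map_variableChange]; rfl
  rw [hbc] at hgood
  exact (hasGoodReductionAt_smul_iff_holds v (W.baseChange L) _).mp hgood

/-- **Semistability on the habitat**: `4 ∣ e(v|3)` ⟹ `E_L` is semistable at `v` (it is even good,
`hasGoodReductionAt_baseChange_of_four_dvd_ramificationIdx`). [cite: SerreTate1968, §2 Cor. 2] -/
theorem isSemistableAt_baseChange_of_four_dvd_ramificationIdx (hadd : Addv W 3)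
    (hsub : Summit.BirchSwinnertonDyer.Rank1Residual.Additive.SubTprime W 3)
    (L : Type) [Field L] [NumberField L] (v : HeightOneSpectrum (𝓞 L))
    (h3 : ((3 : ℕ) : 𝓞 L) ∈ v.asIdeal) (h4 : 4 ∣ v.asIdeal.ramificationIdx ℤ) :
    (W.baseChange L).IsSemistableAt v :=
  Or.inl (hasGoodReductionAt_baseChange_of_four_dvd_ramificationIdx W hadd hsub L v h3 h4)

/-- **The child's good-reduction binder is dischargeable.** In the binder currency of
`LowerBSD3OverSolventQuartic` (stmt-BirchSwinnertonDyer-23963): for `W` on the (t′) leaf and ANY number field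
`M`, «`e(w|3) = 4` at every place `w ∣ 3`» implies «`W ⊗ M` has good reduction at every place `w ∣ 3`» (the
line's stub `stub_goodReduction`, place by place). So of the child's two local hypotheses only the
ramification one carries content. [cite: SerreTate1968, §2 Cor. 2] [cite: SilvermanAEC2009, Prop. VII.5.1(a)] -/
theorem forall_hasGoodReductionAt_of_forall_ramificationIdx_eq_four (hadd : Addv W 3)
    (hsub : Summit.BirchSwinnertonDyer.Rank1Residual.Additive.SubTprime W 3)
    (M : Type) [Field M] [NumberField M]
    (he : ∀ w : HeightOneSpectrum (𝓞 M), ((3 : ℕ) : 𝓞 M) ∈ w.asIdeal → w.asIdeal.ramificationIdx ℤ = 4) :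
    ∀ w : HeightOneSpectrum (𝓞 M), ((3 : ℕ) : 𝓞 M) ∈ w.asIdeal → (W.baseChange M).HasGoodReductionAt w :=
  fun w hw ↦ stub_goodReduction W hadd hsub M w hw (he w hw)

/-! ## §2 Supersingularity on the whole habitat -/

/-- **`a_v = 0` on the whole habitat.** For `W/ℚ` globally minimal, elliptic, (t′) at `3`, every number
field `L` and every place `v ∋ 3` with `4 ∣ e(v|3)` and ODD residue degree `f(v|3)`: the Frobenius trace of
`W ⊗ L` at `v` vanishes — good SUPERSINGULAR reduction with `a_v = 0`. Proof: with `e(v|3) = 4m`, `m ≥ 1`,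
the companion model of `exists_rat_model_of_subTprime` has `k ∈ {1, 3}` ODD, so `ik ≤ 4·ord₃ aᵢ` is strict
for `i = 1, 2, 3, 6`, and stays strict after scaling to `(e, k) := (4m, mk)`; the rescaled model reduces to
`y² = x³ + ā₄x` over `k_v` with `#k_v = 3^f ≡ 3 (mod 4)`, which has `#k_v + 1` points
(`frobeniusTraceAt_baseChange_eq_zero_of_padicValRat`; Ireland–Rosen 18.4 Thm. 5), and `a_v` is invariant under
the change of variables (Silverman VII.1.3(b), C.§16). Serre–Tate picture: Frobenius swaps the `±i`-eigenlines
of tame inertia, so its trace is `0`. Extends `frobeniusTraceAt_baseChange_eq_zero_of_subTprime` (`e = 4`).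
[cite: SilvermanAEC2009, VII.1 Prop. 1.3(b), VII.5.1(a), C.§16] [cite: IrelandRosen1990, Ch. 18 §4, Theorem 5]
[cite: SerreTate1968, §2 Cor. 2] -/
theorem frobeniusTraceAt_baseChange_eq_zero_of_four_dvd_ramificationIdx (hadd : Addv W 3)
    (hsub : Summit.BirchSwinnertonDyer.Rank1Residual.Additive.SubTprime W 3)
    (L : Type) [Field L] [NumberField L] (v : HeightOneSpectrum (𝓞 L))
    (h3 : ((3 : ℕ) : 𝓞 L) ∈ v.asIdeal) (h4 : 4 ∣ v.asIdeal.ramificationIdx ℤ)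
    (hf : Odd (v.asIdeal.inertiaDeg ℤ)) :
    (W.baseChange L).frobeniusTraceAt v = 0 := by
  have hq := natCard_quotient_mod_four_of_odd_inertiaDeg L v h3 hf
  obtain ⟨m, hm⟩ := h4
  have hm1 : (1 : ℤ) ≤ m := by
    have hne := ramificationIdx_int_ne_zero_of_natCast_mem L v 3 h3
    rw [hm] at hne
    exact_mod_cast Nat.one_le_iff_ne_zero.mpr (fun h0 ↦ hne (by rw [h0, mul_zero]))
  obtain ⟨C, k, hk, hΔ, h₁, h₂, h₃, h₄, h₆⟩ := exists_rat_model_of_subTprime W hadd hsub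
  haveI : (C • W).IsElliptic := inferInstance
  -- `k` odd: the inequalities are strict for `i = 1, 2, 3, 6`; scale by `m ≥ 1`
  have h₁' : (C • W).a₁ = 0 ∨ ((m * k : ℕ) : ℤ) < ((4 * m : ℕ) : ℤ) * padicValRat 3 (C • W).a₁ := by
    rcases h₁ with h | h
    · exact Or.inl h
    · right
      have h' : (k : ℤ) < 4 * padicValRat 3 (C • W).a₁ := by rcases hk with rfl | rfl <;> omega
      push_cast; nlinarith
  have h₂' : (C • W).a₂ = 0 ∨ 2 * ((m * k : ℕ) : ℤ) < ((4 * m : ℕ) : ℤ) * padicValRat 3 (C • W).a₂ := by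
    rcases h₂ with h | h
    · exact Or.inl h
    · right
      have h' : 2 * (k : ℤ) < 4 * padicValRat 3 (C • W).a₂ := by rcases hk with rfl | rfl <;> omega
      push_cast; nlinarith
  have h₃' : (C • W).a₃ = 0 ∨ 3 * ((m * k : ℕ) : ℤ) < ((4 * m : ℕ) : ℤ) * padicValRat 3 (C • W).a₃ := by
    rcases h₃ with h | h
    · exact Or.inl h
    · right
      have h' : 3 * (k : ℤ) < 4 * padicValRat 3 (C • W).a₃ := by rcases hk with rfl | rfl <;> omega
      push_cast; nlinarith
  have h₄' : (C • W).a₄ = 0 ∨ 4 * ((m * k : ℕ) : ℤ) ≤ ((4 * m : ℕ) : ℤ) * padicValRat 3 (C • W).a₄ :=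
    h₄.imp id fun h ↦ by push_cast; nlinarith
  have h₆' : (C • W).a₆ = 0 ∨ 6 * ((m * k : ℕ) : ℤ) < ((4 * m : ℕ) : ℤ) * padicValRat 3 (C • W).a₆ := by
    rcases h₆ with h | h
    · exact Or.inl h
    · right
      have h' : 6 * (k : ℤ) < 4 * padicValRat 3 (C • W).a₆ := by rcases hk with rfl | rfl <;> omega
      push_cast; nlinarith
  have hzero : ((C • W).baseChange L).frobeniusTraceAt v = 0 :=
    frobeniusTraceAt_baseChange_eq_zero_of_padicValRat (C • W) 3 (e := 4 * m) (k := m * k)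
      (by rw [hΔ]; push_cast; ring) h₁' h₂' h₃' h₄' h₆' L v h3 hm hq
  have hbc : (C • W).baseChange L = (C.map (algebraMap ℚ L)) • W.baseChange L := by
    rw [WeierstrassCurve.baseChange, ← map_variableChange]; rfl
  haveI : (W.baseChange L).IsElliptic := by
    rw [WeierstrassCurve.baseChange]; infer_instance
  rw [hbc, WeierstrassCurve.frobeniusTraceAt_smul (W.baseChange L) _ v
    (hasGoodReductionAt_baseChange_of_four_dvd_ramificationIdx W hadd hsub L v h3 ⟨m, hm⟩)] at hzero
  exact hzero

/-- **`#Ẽ_v(k_v) = #k_v + 1` on the whole habitat** (point-count form of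
`frobeniusTraceAt_baseChange_eq_zero_of_four_dvd_ramificationIdx`: `4 ∣ e(v|3)`, `f(v|3)` odd).
[cite: SilvermanAEC2009, C.§16] [cite: IrelandRosen1990, Ch. 18 §4, Theorem 5] -/
theorem natCard_point_reductionAt_baseChange_of_four_dvd_ramificationIdx (hadd : Addv W 3)
    (hsub : Summit.BirchSwinnertonDyer.Rank1Residual.Additive.SubTprime W 3)
    (L : Type) [Field L] [NumberField L] (v : HeightOneSpectrum (𝓞 L))
    (h3 : ((3 : ℕ) : 𝓞 L) ∈ v.asIdeal) (h4 : 4 ∣ v.asIdeal.ramificationIdx ℤ)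
    (hf : Odd (v.asIdeal.inertiaDeg ℤ)) :
    Nat.card ((W.baseChange L).reductionAt v).toAffine.Point = Nat.card (𝓞 L ⧸ v.asIdeal) + 1 := by
  have h := frobeniusTraceAt_baseChange_eq_zero_of_four_dvd_ramificationIdx W hadd hsub L v h3 h4 hf
  rw [frobeniusTraceAt_def,
    IsDedekindDomain.HeightOneSpectrum.natCard_residueField_adicCompletionIntegers L v] at h
  omega

/-! ## §3 Semistable means good: the (t′) leaf is never multiplicative above `3` -/

/-- **Never multiplicative upstairs.** A (t′) curve at `3` is potentially good (`ord₃ j ≥ 0`, the `¬ PotMult`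
conjunct of `SubTprime`), so over every number field `L` and at every place `v ∋ 3`, `W ⊗ L` does NOT have
multiplicative reduction at `v` (`Additive.not_hasMultiplicativeReductionAt_baseChange_of_padicValRat_j_nonneg`,
Silverman VII.5.1(b)). [cite: SilvermanAEC2009, Prop. VII.5.1(b)] -/
theorem not_hasMultiplicativeReductionAt_baseChange_of_subTprime
    (hsub : Summit.BirchSwinnertonDyer.Rank1Residual.Additive.SubTprime W 3)
    (L : Type) [Field L] [NumberField L] (v : HeightOneSpectrum (𝓞 L))
    (h3 : ((3 : ℕ) : 𝓞 L) ∈ v.asIdeal) :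
    ¬ (W.baseChange L).HasMultiplicativeReductionAt v := by
  have hj : 0 ≤ padicValRat 3 W.j := by
    have h := hsub.1
    unfold PotMult at h
    exact not_lt.mp h
  exact not_hasMultiplicativeReductionAt_baseChange_of_padicValRat_j_nonneg W 3 L v hj h3

/-- **Semistable at `v` ⟹ good at `v`, for the (t′) leaf.** There is no "semistable-but-not-good" base for a
(t′) curve above `3` (repair-census entry R5 of `LEAD-g4-21391.md` §2 in kernel form): if `W ⊗ L` is
semistable at a place `v ∋ 3` then it is good there (`not_hasMultiplicativeReductionAt_baseChange_of_subTprime`).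
In particular the semistable-reduction habitat of the leaf above `3` equals its good-reduction habitat.
[cite: SilvermanAEC2009, Prop. VII.5.1(b)] -/
theorem hasGoodReductionAt_of_isSemistableAt_baseChange
    (hsub : Summit.BirchSwinnertonDyer.Rank1Residual.Additive.SubTprime W 3)
    (L : Type) [Field L] [NumberField L] (v : HeightOneSpectrum (𝓞 L))
    (h3 : ((3 : ℕ) : 𝓞 L) ∈ v.asIdeal) (hss : (W.baseChange L).IsSemistableAt v) :
    (W.baseChange L).HasGoodReductionAt v :=
  hss.resolve_right (not_hasMultiplicativeReductionAt_baseChange_of_subTprime W hsub L v h3)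

/-- **Semistable at `v` ↔ good at `v`** on the (t′) leaf above `3` (the two habitats coincide).
[cite: SilvermanAEC2009, Prop. VII.5.1(b)] -/
theorem isSemistableAt_baseChange_iff_hasGoodReductionAt
    (hsub : Summit.BirchSwinnertonDyer.Rank1Residual.Additive.SubTprime W 3)
    (L : Type) [Field L] [NumberField L] (v : HeightOneSpectrum (𝓞 L))
    (h3 : ((3 : ℕ) : 𝓞 L) ∈ v.asIdeal) :
    (W.baseChange L).IsSemistableAt v ↔ (W.baseChange L).HasGoodReductionAt v :=
  ⟨hasGoodReductionAt_of_isSemistableAt_baseChange W hsub L v h3, Or.inl⟩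

end Summit.BirchSwinnertonDyer.BirchSwinnertonDyer.Theorems.LowerBSD3OverSolventQuartic

end
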